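import Mathlib

/-!
# The torus leg of `HarmonicMeasureEngine` — analytic preliminaries

Helper file for item `stmt-QuantumFields-18844` (`HarmonicMeasureEngine`, route `ComplexCouplingChannel` of
`QuantumFields/YangMills`), abstract-analytic part of the "new thermal leg".  For a family of functions
`Z P : ℂ → ℂ` (the symmetric-torus partition functions `Z(z; P, P)`) we assume exactly the shapes of the
route's hypotheses:

* (anchor, torus clause of `ComplexStrongCouplingAnchor`) on the strong-coupling disc `‖z‖ < ρ₀`: `Z P` is
  holomorphic and zero-free, `Z P 0 = 1`, and `|log ‖Z P z‖ + P⁴ Re f_A z| ≤ C P⁴ e^{-cP}` for one analytic `f_A`;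
* (window, `FreeEnergyWindowChannel`) on an open connected channel `D ∋ β` containing a point `x` of the
  disc: `Z P` holomorphic and zero-free and `|log ‖Z P z‖ + P⁴ Re f z| ≤ M` for `P ≥ P₀`, one analytic `f`.

The conclusion (exponential smallness of the finite-size free energy at `β`) is proved in the sequel file
`ComplexCouplingChannelHarmonicMeasureEngineTorusLeg.lean`; this file holds its self-contained analytic
preliminaries: a normalised holomorphic logarithm on a disc (`exists_differentiableOn_exp_eq`, primitive of
`Z'/Z`), Borel–Carathéodory with a small real centre value (`norm_le_of_re_le_of_norm_zero_le`), constancy of a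
holomorphic function with vanishing real part (`exists_eq_const_of_re_eq_zero`, open mapping theorem), and
three elementary real estimates.

References: Mathlib `Complex.borelCaratheodory`, `DifferentiableOn.isExactOn_ball`,
`AnalyticOnNhd.is_constant_or_isOpen`.
-/

open Complex Metric Set Filter Topology

namespace Summit.QuantumFields.YangMills.Theorems.ComplexCouplingChannel

/-- **Holomorphic logarithm on a disc, normalised at the centre.**  A function holomorphic and zero-free
on `ball 0 R` with value `1` at `0` is `exp ∘ g` for a holomorphic `g` on the ball with `g 0 = 0`
(primitive of the logarithmic derivative on a disc, Mathlib `DifferentiableOn.isExactOn_ball`). [folklore] -/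
theorem exists_differentiableOn_exp_eq {Z : ℂ → ℂ} {R : ℝ} (hR : 0 < R)
    (hZ : DifferentiableOn ℂ Z (ball 0 R)) (hZ0 : ∀ z ∈ ball 0 R, Z z ≠ 0) (h1 : Z 0 = 1) :
    ∃ g : ℂ → ℂ, DifferentiableOn ℂ g (ball 0 R) ∧ g 0 = 0 ∧ ∀ z ∈ ball 0 R, exp (g z) = Z z := by
  have hq : DifferentiableOn ℂ (fun z => deriv Z z / Z z) (ball 0 R) := (hZ.deriv isOpen_ball).div hZ hZ0
  obtain ⟨g, hg0, hg⟩ := hq.isExactOn_ball.with_val_at 0 0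
  have hgd : DifferentiableOn ℂ g (ball 0 R) := fun z hz =>
    (hg z hz).differentiableAt.differentiableWithinAt
  refine ⟨g, hgd, hg0, ?_⟩
  -- `Z e^{-g}` has zero derivative on the ball
  set w : ℂ → ℂ := fun z => Z z * exp (-g z) with hw
  have hwd : DifferentiableOn ℂ w (ball 0 R) := hZ.mul hgd.neg.cexp
  have hderiv : (ball 0 R).EqOn (deriv w) 0 := by
    intro z hz
    have hZ' : HasDerivAt Z (deriv Z z) z := (hZ.differentiableAt (isOpen_ball.mem_nhds hz)).hasDerivAt
    have he : HasDerivAt (fun y => exp (-g y)) (exp (-g z) * -(deriv Z z / Z z)) z := (hg z hz).neg.cexp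
    have hw' : HasDerivAt w (deriv Z z * exp (-g z) + Z z * (exp (-g z) * -(deriv Z z / Z z))) z :=
      hZ'.mul he
    rw [Pi.zero_apply, hw'.deriv]
    field_simp [hZ0 z hz]
    ring
  intro z hz
  have hconst := isOpen_ball.is_const_of_deriv_eq_zero (convex_ball (0 : ℂ) R).isPreconnected hwd hderiv
    hz (mem_ball_self hR)
  simp only [hw, h1, hg0, neg_zero, exp_zero, mul_one] at hconst
  calc exp (g z) = exp (g z) * (Z z * exp (-g z)) := by rw [hconst, mul_one]
    _ = Z z := by rw [mul_left_comm, ← exp_add, add_neg_cancel, exp_zero, mul_one]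

/-- **Borel–Carathéodory with a small real centre value**: if `φ` is holomorphic on `ball 0 R` with
`Re φ ≤ η` there and `‖φ 0‖ ≤ η` (`η > 0`), then `‖φ z‖ ≤ η (R + 3r)/(R − r)` for `‖z‖ ≤ r < R`. [folklore] -/
theorem norm_le_of_re_le_of_norm_zero_le {φ : ℂ → ℂ} {R r η : ℝ} (hr0 : 0 ≤ r) (hr : r < R) (hη : 0 < η)
    (hφ : DifferentiableOn ℂ φ (ball 0 R)) (hre : ∀ z ∈ ball 0 R, (φ z).re ≤ η) (h0 : ‖φ 0‖ ≤ η)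
    {z : ℂ} (hz : ‖z‖ ≤ r) : ‖φ z‖ ≤ η * ((R + 3 * r) / (R - r)) := by
  have hR : 0 < R := lt_of_le_of_lt hr0 hr
  have hzR : z ∈ ball (0 : ℂ) R := by rw [mem_ball_zero_iff]; exact lt_of_le_of_lt hz hr
  have hbc := borelCaratheodory hη hφ (fun w hw => hre w hw) hR hzR
  have hden : 0 < R - ‖z‖ := by linarith
  have h1 : 2 * η * ‖z‖ / (R - ‖z‖) ≤ 2 * η * r / (R - r) := by
    rw [div_le_div_iff₀ hden (by linarith)]
    nlinarith [mul_nonneg (mul_nonneg hη.le hR.le) (sub_nonneg.2 hz), norm_nonneg z]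
  have h2 : ‖φ 0‖ * (R + ‖z‖) / (R - ‖z‖) ≤ η * (R + r) / (R - r) := by
    rw [div_le_div_iff₀ hden (by linarith)]
    have h3 : ‖φ 0‖ * (R + ‖z‖) ≤ η * (R + r) :=
      mul_le_mul h0 (by linarith) (by positivity) hη.le
    have h4 : (0 : ℝ) ≤ ‖φ 0‖ * (R + ‖z‖) := by positivity
    nlinarith [norm_nonneg z]
  calc ‖φ z‖ ≤ 2 * η * ‖z‖ / (R - ‖z‖) + ‖φ 0‖ * (R + ‖z‖) / (R - ‖z‖) := hbc
    _ ≤ 2 * η * r / (R - r) + η * (R + r) / (R - r) := add_le_add h1 h2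
    _ = η * ((R + 3 * r) / (R - r)) := by
        field_simp
        ring

/-- **A holomorphic function with vanishing real part on a ball is constant** (open mapping theorem:
a non-constant holomorphic map is open, and the imaginary axis has empty interior). [folklore] -/
theorem exists_eq_const_of_re_eq_zero {u : ℂ → ℂ} {x : ℂ} {r : ℝ} (hr : 0 < r)
    (hu : DifferentiableOn ℂ u (ball x r)) (hre : ∀ z ∈ ball x r, (u z).re = 0) :
    ∃ w : ℂ, w.re = 0 ∧ ∀ z ∈ ball x r, u z = w := by
  rcases (hu.analyticOnNhd isOpen_ball).is_constant_or_isOpen (convex_ball x r).isPreconnected with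
    ⟨w, hw⟩ | hopen
  · refine ⟨w, ?_, hw⟩
    rw [← hw x (mem_ball_self hr)]
    exact hre x (mem_ball_self hr)
  · exfalso
    have himg : IsOpen (u '' ball x r) := hopen _ Subset.rfl isOpen_ball
    have hmem : u x ∈ u '' ball x r := mem_image_of_mem u (mem_ball_self hr)
    obtain ⟨ε, hε0, hε⟩ := Metric.isOpen_iff.1 himg (u x) hmem
    have hmem' : u x + (ε / 2 : ℝ) ∈ u '' ball x r := by
      refine hε ?_
      rw [mem_ball, dist_eq_norm, add_sub_cancel_left, norm_real, Real.norm_eq_abs, abs_of_pos (by positivity)]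
      linarith
    obtain ⟨z, hz, hzx⟩ := hmem'
    have h1 := hre z hz
    rw [hzx, add_re, ofReal_re, hre x (mem_ball_self hr)] at h1
    linarith

/-- `|log ‖W‖| ≤ 2 ‖W − 1‖` as soon as `‖W − 1‖ ≤ 1/2`. [folklore] -/
theorem abs_log_norm_le_two_mul_norm_sub_one {W : ℂ} (h : ‖W - 1‖ ≤ 1 / 2) :
    |Real.log ‖W‖| ≤ 2 * ‖W - 1‖ := by
  set t : ℝ := ‖W - 1‖ with ht
  have ht0 : 0 ≤ t := norm_nonneg _
  have hlow : 1 - t ≤ ‖W‖ := by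
    have h3 := norm_sub_norm_le (1 : ℂ) W
    rw [norm_one, norm_sub_rev] at h3
    linarith
  have hup : ‖W‖ ≤ 1 + t := by
    have h3 := norm_add_le (W - 1) 1
    rw [sub_add_cancel, norm_one] at h3
    linarith
  have hWpos : 0 < ‖W‖ := by linarith
  rw [abs_le]
  constructor
  · have h1 := Real.one_sub_inv_le_log_of_pos hWpos
    have h2 : (‖W‖)⁻¹ ≤ (1 - t)⁻¹ := by
      rw [inv_le_inv₀ hWpos (by linarith)]; exact hlow
    have h3 : (1 - t)⁻¹ ≤ 1 + 2 * t := by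
      have key : 1 ≤ (1 - t) * (1 + 2 * t) := by nlinarith
      have h1t : (0 : ℝ) < 1 - t := by linarith
      calc (1 - t)⁻¹ = (1 - t)⁻¹ * 1 := (mul_one _).symm
        _ ≤ (1 - t)⁻¹ * ((1 - t) * (1 + 2 * t)) := mul_le_mul_of_nonneg_left key (inv_nonneg.2 h1t.le)
        _ = 1 + 2 * t := by rw [← mul_assoc, inv_mul_cancel₀ h1t.ne', one_mul]
    linarith
  · have h1 := Real.log_le_sub_one_of_pos hWpos
    linarith

/-- `t⁴ e^{−bt} ≤ 24 / b⁴` for `t ≥ 0`, `b > 0` (from `x⁴/4! ≤ eˣ`). [folklore] -/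
theorem pow_four_mul_exp_neg_le {b t : ℝ} (hb : 0 < b) (ht : 0 ≤ t) :
    t ^ 4 * Real.exp (-(b * t)) ≤ 24 / b ^ 4 := by
  have h := Real.pow_div_factorial_le_exp (b * t) (mul_nonneg hb.le ht) 4
  have h24 : ((Nat.factorial 4 : ℕ) : ℝ) = 24 := by norm_num [Nat.factorial]
  rw [h24, div_le_iff₀ (by norm_num : (0 : ℝ) < 24)] at h
  rw [le_div_iff₀ (by positivity), Real.exp_neg]
  have hexp : 0 < Real.exp (b * t) := Real.exp_pos _
  rw [mul_comm (t ^ 4), mul_assoc, ← div_eq_inv_mul, div_le_iff₀ hexp] at *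
  nlinarith [h, hexp]

/-- `B e^{−at} ≤ 1/2` as soon as `2B ≤ at`. [folklore] -/
theorem mul_exp_neg_le_half {B a t : ℝ} (h : 2 * B ≤ a * t) :
    B * Real.exp (-(a * t)) ≤ 1 / 2 := by
  have h1 : a * t + 1 ≤ Real.exp (a * t) := Real.add_one_le_exp _
  have h2 : 2 * B ≤ Real.exp (a * t) := by linarith
  rw [Real.exp_neg, ← div_eq_mul_inv, div_le_iff₀ (Real.exp_pos _)]
  linarith

end Summit.QuantumFields.YangMills.Theorems.ComplexCouplingChannel
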